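import Summits.QuantumFields.BalabanUV.T4Continuum.Support.NE7ApeOfTorusRoadOwned
import HarnessLib

/-!
# NE7ApeFlatSkeletonLocalised — TORUS ROAD v2: F245's flat bootstrap with TWO-REGION source densities (near ∕ far from the plaquette) and a
# LOCALISED slice solver letter (far sources discounted by a decay factor `ϵ`), and its END with the owned letters discharged — so that a local chart of
# PRINT's quality ([Balaban1985Variational] Thm 1 (9)–(10), [Balaban1985RegularSpaces] Thm 2 (1.36): sup AND gradient constants ∝ the cube size) suffices

Cell `pub-balaban`, rung (B)+1 sub-cell t4, lineage `b2b-balaban-t4-ne7-p1` (CRUX PROVER NE7 #1 = OWNER of row NE7), generation 89; memo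
`t4/b2b-balaban-t4-ne7-p1-g89/COSTING-N1.md` §2–§3.  File F252 (over F245 `NE7ApeFlatSkeletonLocal`, F243 `NE7ApeOfLocalChartLetter`, F251 `NE7ApeOfTorusRoadOwned`
(§2 `exists_flat_normalPart`), F48b `NE7ExpansionRemainderFlat`).

WHY (memo §2, the gen-89 costing of (N1)).  In the torus road of gen 88 (F245∕F246∕F251) the slice solver G♭ is a GLOBAL sup row (`‖d_1X‖_∞ ≤ K·M·g`, `g` the
global `(ℓ¹)*`-density of the Hessian source), so the cutoff's shell commutators `(∇χ)(∇A) ≍ R⁻¹M⁻¹·α₁` enter undiscounted and the road needs a local chart whose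
GRADIENT currency `α₁ = c′·r∕M²` has `c′ = o(R)` in the cube radius `R` — whereas print's charts have `c′ ∝ R` ([Balaban1985Variational] (9): `|∇^ηA| < B₃Mε₁(L^jη)⁻²`,
`M` = the cube size; [Balaban1985RegularSpaces] (1.36)), and the cheap constructions (axial gauge, radial gauge) have `c′ ≳ R` as well (memo §2(b)).  Print's
Sect. F discounts far data EXPONENTIALLY through the kernel decay of the flat operators ((161)∕(163), «(2.47)–(2.51) of [3]»).  The tree holds that decay at
`U = 1`: GAN24's `Entry110Rect.entry110Grad_one` ([Balaban1984PropagatorsI] (1.110) entry 2, `|∇Δ_1⁻¹J|` with `e^{−δ₀·dist}` between unit cubes, every torus) and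
lit-balaban's `H_k` column decay (`B5Hk163TorusHolderRate`).  THIS FILE re-types the bootstrap so that such a LOCALISED row can be consumed: every source
functional is bounded by a NEAR density (an `ℓ¹` norm over a finite set `Bn` around the plaquette) plus a FAR density (over `Bf`), and the solver letter at the
plaquette reads `‖d_{F̃}X(p)‖ ≤ K_G·(a + ϵ·b)` for sources `≤ a‖Y‖_{1,Bn} + b‖Y‖_{1,Bf}`.  With `ϵ ≍ e^{−R∕c}` the shell terms carry `ϵ·C′(R)` and ANY polynomial
chart constants close the numeric line (memo §3): the chart input of the torus road drops from «NOT-IN-PRINT sharpening» to «[B8] Thm 2 at `U₀ = 1` on nested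
cubes, VERBATIM ((152))» — the same (SF3) print's own road uses.
WHAT ([folklore] composition; 0 def, 0 sorry).
§1 **`norm_plaq_vary_sub_one_le_of_localisedLetters`** — F245 §1 with: the solver letter LOCALISED at the plaquette (`hGloc`, parameters `Bn Bf : Finset`, `ϵ ≥ 0`,
   `K_G`); the expansion letter and the criticality defect in TWO-REGION form (`ρn, ρf`; `τn, τf`).  Conclusion:
   `‖Ũ(∂p) − 1‖ ≤ K_G((τn + ρn) + ϵ(τf + ρf)) + ‖curlAt F̃ A_N z μ ν‖ + 28α₀²`.
§2 **`norm_plaq_sub_one_le_of_localisedLetters_gauge`** — the same for `U` through a unitary gauge matching `Ũ` on the four bonds (F245 §2).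
§3 **`hape_of_torusRoadLocalised`** — THE v2 END with the owned letters discharged as in F251 (`F̃ := 1`, `A_N :=` F251 §2's skew exact north lift with the
   GLOBAL (R7♭) curl bound `card n·(C_H∕M)·(ĝ∕M)`, `S := univ`, EXP := F48b's global density `ρ(α₀,α₁)` entered in both regions): `hape` ⇐ per plaquette
   `∃ A α₀ α₁ τn τf ĝ u Bn Bf ϵ K_G` — the chart (skew periodic, `‖A‖ ≤ α₀`, `‖∇A‖ ≤ α₁`, coarse curl of `D_1A ≤ ĝ`); the two-region defect letter; the gauge
   matching; the LOCALISED SOLVER LETTER at the plaquette (a hypothesis here — its discharge from `entry110Grad_one` + `H_k` decay is the successor file G♭-loc);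
   the line `K_G((τn + ρ) + ϵ(τf + ρ)) + card n·(C_H∕M)·(ĝ∕M) + 28α₀² ≤ (c₀ + θr)∕M²`.
HONEST FRAMING (page 1): composition over HYPOTHESES; G♭-loc, the chart (N1) ([B8] Thm 2 TYPE at `U₀ = 1`, local) and the defect assembly (N2) are asserted for
nothing and NOT in the tree; the normal part's row is still the GLOBAL (R7♭) (its localisation, needed for the shell part of `ĝ`, is a successor file); nothing of
Bałaban's asserted; NOT (APE), NOT ONE-STEP, NOT NE7; spine 0∕9; finite T⁴ rung (B)+1 — NOT infinite volume, NOT mass gap, NOT `BetaPertH`, NOT Clay.  Continuum YM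
on T⁴ ⇐ BetaPertH ∧ nine spine estimates (0/9 proved); BetaPertH ⇐ (D1) ∧ (D4) ∧ CAP+tail; G-an2-4 gates asym, D1 and NE2/3/4.
-/

set_option autoImplicit false

open scoped BigOperators Matrix.Norms.L2Operator
open NormedSpace Finset Set

namespace Summit.QuantumFields.BalabanUV.T4Continuum.NE7ApeFlatSkeletonLocalised

open Literature.MathematicalPhysics.QuantumFieldTheory.Balaban1983to89
open B7Prop1Explicit B7Prop2Explicit MatrixLog UnitaryModel
open T4AveragingDeficitWall (IsUnitaryCfg IsSkewDir SmallField vary curlAt dirL1 flat_mem_classes)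
open T4AveragingDeficitWallBoundary (IsPeriodicCfg periodBox)
open AveragingDeficitPeriodicCounting (IsPeriodicDir)
open AveragingDeficitMultiLevelPrep (LevelSmall TangentIter)
open MinimalActionLevels (perWin)
open MinimalActionSandwich (admissible)
open MinimalActionRate (sfClass)
open BlockAveragePushDirSplit (flat)
open B4Sect5Proof (latticeConst)
open B5Hk163Strip (kappa163)
open B5Hk163TorusHolderDecay (CdecD)
open NE3HessForm (hess dAction)
open NE3TangentCovariantTower (dirIter)
open NE3ResidualSliceRep (dirIter_sub)
open NE3EnergyHessBilin (hess_add_left)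
open NE3EnergyShapes (IsUnitarySite)
open NE7ApeFlatSkeleton (norm_hol_vary_flat_sub_one_le curlAt_eq_add_of_split)
open NE7ApeFlatSkeletonLocal (hol_plaqWord_congr)
open NE7ApeOfLocalChartLetter (norm_plaq_sub_one_le_gaugeAct smallField_floor_of_affineImprovement)
open NE7ExpansionRemainderFlat (abs_dAction_vary_sub_hess_flat_le)
open NE7CoarseCurvatureLetter (levelSmall_zero)
open NE7ApeOfTorusRoadOwned (exists_flat_normalPart)

noncomputable section

variable {d : ℕ} {n : Type*} [Fintype n] [DecidableEq n]

/-! ## §0 Two-region bookkeeping of the `ℓ¹` norm -/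

/-- If `B ⊆ Bn ∪ Bf` then `‖Y‖_{1,B} ≤ ‖Y‖_{1,Bn} + ‖Y‖_{1,Bf}` (nonnegative summands). [folklore] -/
theorem dirL1_le_add_of_subset_union (Y : Site d → Fin d → Matrix n n ℂ) {B Bn Bf : Finset (Site d)} (h : B ⊆ Bn ∪ Bf) :
    dirL1 Y B ≤ dirL1 Y Bn + dirL1 Y Bf := by
  classical
  simp only [dirL1]
  have h1 : ∑ x ∈ B, ∑ κ : Fin d, ‖Y x κ‖ ≤ ∑ x ∈ Bn ∪ Bf, ∑ κ : Fin d, ‖Y x κ‖ :=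
    Finset.sum_le_sum_of_subset_of_nonneg h (fun x _ _ => Finset.sum_nonneg fun κ _ => norm_nonneg _)
  have h2 := Finset.sum_union_inter (s₁ := Bn) (s₂ := Bf) (f := fun x => ∑ κ : Fin d, ‖Y x κ‖)
  have h3 : 0 ≤ ∑ x ∈ Bn ∩ Bf, ∑ κ : Fin d, ‖Y x κ‖ := Finset.sum_nonneg fun x _ => Finset.sum_nonneg fun κ _ => norm_nonneg _
  linarith

/-! ## §1 The flat bootstrap with two-region densities and a localised solver letter -/

/-- **THE FLAT BOOTSTRAP, LOCALISED FORM** (F245 §1 with two-region densities): for `Ũ = F̃e^{A}` (letters as in F245: `F̃` flat, `A` skew periodic with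
`‖A‖ ≤ α₀`, the normal part `A_N` skew periodic EXACT and NORTH, the slice `S ∋ A − A_N`), if at the plaquette `(z; μ ≠ ν)` the slice solver letter holds in the
LOCALISED form `hGloc` (sources `≤ a‖Y‖_{1,Bn} + b‖Y‖_{1,Bf}` on skew periodic flat tangents give `‖curlAt F̃ X z μ ν‖ ≤ K_G(a + ϵb)`), the expansion letter holds
with densities `(ρn, ρf)` and the criticality defect with `(τn, τf)` on the two regions, then
`‖Ũ(∂p_{μν}(z)) − 1‖ ≤ K_G((τn + ρn) + ϵ(τf + ρf)) + ‖curlAt F̃ A_N z μ ν‖ + 28α₀²`. [folklore] -/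
theorem norm_plaq_vary_sub_one_le_of_localisedLetters [Nonempty n] {L : ℕ} (hL : 1 ≤ L) (k : ℕ) {P : ℕ}
    {Ft : Site d → Fin d → (Matrix n n ℂ)ˣ} (hFt : IsUnitaryCfg Ft) (hFt0 : SmallField Ft 0)
    {x : ℝ} (hx : 0 ≤ x) (hs : LevelSmall d L k x) (hFtx : SmallField Ft x)
    {A : Site d → Fin d → Matrix n n ℂ} (hA : IsSkewDir A) (hAP : IsPeriodicDir A (P : ℤ)) {α₀ : ℝ} (hAα : ∀ y μ, ‖A y μ‖ ≤ α₀)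
    -- the normal part: exactness and (R⊥) output
    {AN : Site d → Fin d → Matrix n n ℂ} (hNs : IsSkewDir AN) (hNP : IsPeriodicDir AN (P : ℤ))
    (hNexact : dirIter L (k + 1) Ft AN = dirIter L (k + 1) Ft A)
    (hNorth : ∀ Y : Site d → Fin d → Matrix n n ℂ, IsSkewDir Y → IsPeriodicDir Y (P : ℤ) → dirIter L (k + 1) Ft Y = 0 →
      hess Ft AN Y (perWin d P) = 0)
    -- the gauge slice, the two regions, and the LOCALISED slice solver letter at the plaquette
    (S : Set (Site d → Fin d → Matrix n n ℂ)) (hTS : (fun y μ => A y μ - AN y μ) ∈ S)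
    (Bn Bf : Finset (Site d)) {ϵ KG : ℝ} (z : Site d) {μ ν : Fin d} (hμν : μ ≠ ν)
    (hGloc : ∀ X ∈ S, IsSkewDir X → IsPeriodicDir X (P : ℤ) → dirIter L (k + 1) Ft X = 0 → ∀ a b : ℝ, 0 ≤ a → 0 ≤ b →
      (∀ Y : Site d → Fin d → Matrix n n ℂ, IsSkewDir Y → IsPeriodicDir Y (P : ℤ) → dirIter L (k + 1) Ft Y = 0 →
        |hess Ft X Y (perWin d P)| ≤ a * dirL1 Y Bn + b * dirL1 Y Bf) →
      ‖curlAt Ft X z μ ν‖ ≤ KG * (a + ϵ * b))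
    -- the expansion letter, two-region
    {ρn ρf : ℝ} (hρn : 0 ≤ ρn) (hρf : 0 ≤ ρf)
    (hEXP : ∀ Y : Site d → Fin d → Matrix n n ℂ, IsSkewDir Y → IsPeriodicDir Y (P : ℤ) →
      |dAction (vary Ft A 1) Y (perWin d P) - hess Ft A Y (perWin d P)| ≤ ρn * dirL1 Y Bn + ρf * dirL1 Y Bf)
    -- criticality of the representative UP TO A TWO-REGION DEFECT, tested against FLAT-tangent directions
    {τn τf : ℝ} (hτn : 0 ≤ τn) (hτf : 0 ≤ τf)
    (hcritD : ∀ Y : Site d → Fin d → Matrix n n ℂ, IsSkewDir Y → IsPeriodicDir Y (P : ℤ) → dirIter L (k + 1) Ft Y = 0 →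
      |dAction (vary Ft A 1) Y (perWin d P)| ≤ τn * dirL1 Y Bn + τf * dirL1 Y Bf) :
    ‖((hol (vary Ft A 1) z (plaqWord μ ν) : (Matrix n n ℂ)ˣ) : Matrix n n ℂ) - 1‖
      ≤ KG * ((τn + ρn) + ϵ * (τf + ρf)) + ‖curlAt Ft AN z μ ν‖ + 28 * α₀ ^ 2 := by
  -- the tangent part
  set X : Site d → Fin d → Matrix n n ℂ := fun y μ => A y μ - AN y μ with hXdef
  have hXs : IsSkewDir X := fun y μ => (skewAdjoint (Matrix n n ℂ)).sub_mem (hA y μ) (hNs y μ)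
  have hXP : IsPeriodicDir X (P : ℤ) := fun y i μ => by simp only [hXdef, hAP y i μ, hNP y i μ]
  have hXT : dirIter L (k + 1) Ft X = 0 := by
    rw [hXdef, dirIter_sub hL k hFt hx hs hFtx A AN, hNexact]
    funext z κ
    simp
  -- the two-region source density on the tangent space
  have hsrc : ∀ Y : Site d → Fin d → Matrix n n ℂ, IsSkewDir Y → IsPeriodicDir Y (P : ℤ) → dirIter L (k + 1) Ft Y = 0 →
      |hess Ft X Y (perWin d P)| ≤ (τn + ρn) * dirL1 Y Bn + (τf + ρf) * dirL1 Y Bf := by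
    intro Y hY hYP hYT
    have hsplitA : A = X + AN := by funext y μ; simp [hXdef]
    have hhess : hess Ft X Y (perWin d P) = hess Ft A Y (perWin d P) := by
      have h := hess_add_left Ft (perWin d P) X AN Y
      rw [← hsplitA, hNorth Y hY hYP hYT, add_zero] at h
      exact h.symm
    have hdA := hcritD Y hY hYP hYT
    have hE := hEXP Y hY hYP
    have htri : |hess Ft A Y (perWin d P)| ≤ |dAction (vary Ft A 1) Y (perWin d P)|
        + |dAction (vary Ft A 1) Y (perWin d P) - hess Ft A Y (perWin d P)| := by
      have := abs_sub_abs_le_abs_sub (hess Ft A Y (perWin d P)) (dAction (vary Ft A 1) Y (perWin d P))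
      rw [abs_sub_comm] at this
      linarith
    rw [hhess]
    calc |hess Ft A Y (perWin d P)|
        ≤ (τn * dirL1 Y Bn + τf * dirL1 Y Bf) + (ρn * dirL1 Y Bn + ρf * dirL1 Y Bf) := by linarith
      _ = (τn + ρn) * dirL1 Y Bn + (τf + ρf) * dirL1 Y Bf := by ring
  -- the localised slice solver bounds the tangent part's curl AT THE PLAQUETTE
  have hXz : ‖curlAt Ft X z μ ν‖ ≤ KG * ((τn + ρn) + ϵ * (τf + ρf)) :=
    hGloc X hTS hXs hXP hXT (τn + ρn) (τf + ρf) (add_nonneg hτn hρn) (add_nonneg hτf hρf) hsrc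
  -- the curl of `A` at the given plaquette
  have hsplit : ∀ y κ, A y κ = X y κ + AN y κ := fun y κ => by simp [hXdef]
  have hsplitz : curlAt Ft A z μ ν = curlAt Ft X z μ ν + curlAt Ft AN z μ ν := curlAt_eq_add_of_split Ft hsplit z μ ν
  have hnorm : ‖curlAt Ft X z μ ν + curlAt Ft AN z μ ν‖ ≤ ‖curlAt Ft X z μ ν‖ + ‖curlAt Ft AN z μ ν‖ := norm_add_le _ _
  have hcurlA : ‖curlAt Ft A z μ ν‖ ≤ KG * ((τn + ρn) + ϵ * (τf + ρf)) + ‖curlAt Ft AN z μ ν‖ := by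
    rw [hsplitz]; linarith
  have h := norm_hol_vary_flat_sub_one_le hFt hFt0 hA hAα z hμν
  linarith

/-! ## §2 Reading the plaquette of the configuration of interest through a matching gauge -/

/-- **THE SAME BOUND FOR `U` THROUGH A UNITARY GAUGE MATCHING `Ũ = F̃e^{A}` ON THE FOUR BONDS OF THE PLAQUETTE** (F245 §2 with §1's localised letters).
[folklore] -/
theorem norm_plaq_sub_one_le_of_localisedLetters_gauge [Nonempty n] {L : ℕ} (hL : 1 ≤ L) (k : ℕ) {P : ℕ}
    {Ft : Site d → Fin d → (Matrix n n ℂ)ˣ} (hFt : IsUnitaryCfg Ft) (hFt0 : SmallField Ft 0)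
    {x : ℝ} (hx : 0 ≤ x) (hs : LevelSmall d L k x) (hFtx : SmallField Ft x)
    {A : Site d → Fin d → Matrix n n ℂ} (hA : IsSkewDir A) (hAP : IsPeriodicDir A (P : ℤ)) {α₀ : ℝ} (hAα : ∀ y μ, ‖A y μ‖ ≤ α₀)
    {AN : Site d → Fin d → Matrix n n ℂ} (hNs : IsSkewDir AN) (hNP : IsPeriodicDir AN (P : ℤ))
    (hNexact : dirIter L (k + 1) Ft AN = dirIter L (k + 1) Ft A)
    (hNorth : ∀ Y : Site d → Fin d → Matrix n n ℂ, IsSkewDir Y → IsPeriodicDir Y (P : ℤ) → dirIter L (k + 1) Ft Y = 0 →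
      hess Ft AN Y (perWin d P) = 0)
    (S : Set (Site d → Fin d → Matrix n n ℂ)) (hTS : (fun y μ => A y μ - AN y μ) ∈ S)
    (Bn Bf : Finset (Site d)) {ϵ KG : ℝ} (z : Site d) {μ ν : Fin d} (hμν : μ ≠ ν)
    (hGloc : ∀ X ∈ S, IsSkewDir X → IsPeriodicDir X (P : ℤ) → dirIter L (k + 1) Ft X = 0 → ∀ a b : ℝ, 0 ≤ a → 0 ≤ b →
      (∀ Y : Site d → Fin d → Matrix n n ℂ, IsSkewDir Y → IsPeriodicDir Y (P : ℤ) → dirIter L (k + 1) Ft Y = 0 →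
        |hess Ft X Y (perWin d P)| ≤ a * dirL1 Y Bn + b * dirL1 Y Bf) →
      ‖curlAt Ft X z μ ν‖ ≤ KG * (a + ϵ * b))
    {ρn ρf : ℝ} (hρn : 0 ≤ ρn) (hρf : 0 ≤ ρf)
    (hEXP : ∀ Y : Site d → Fin d → Matrix n n ℂ, IsSkewDir Y → IsPeriodicDir Y (P : ℤ) →
      |dAction (vary Ft A 1) Y (perWin d P) - hess Ft A Y (perWin d P)| ≤ ρn * dirL1 Y Bn + ρf * dirL1 Y Bf)
    {τn τf : ℝ} (hτn : 0 ≤ τn) (hτf : 0 ≤ τf)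
    (hcritD : ∀ Y : Site d → Fin d → Matrix n n ℂ, IsSkewDir Y → IsPeriodicDir Y (P : ℤ) → dirIter L (k + 1) Ft Y = 0 →
      |dAction (vary Ft A 1) Y (perWin d P)| ≤ τn * dirL1 Y Bn + τf * dirL1 Y Bf)
    -- the configuration of interest and a gauge matching the representative on the plaquette
    {U : Site d → Fin d → (Matrix n n ℂ)ˣ} {u : Site d → (Matrix n n ℂ)ˣ} (hu : IsUnitarySite u)
    (h1 : gaugeAct u U z μ = vary Ft A 1 z μ) (h2 : gaugeAct u U (z + e μ) ν = vary Ft A 1 (z + e μ) ν)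
    (h3 : gaugeAct u U (z + e ν) μ = vary Ft A 1 (z + e ν) μ) (h4 : gaugeAct u U z ν = vary Ft A 1 z ν) :
    ‖((hol U z (plaqWord μ ν) : (Matrix n n ℂ)ˣ) : Matrix n n ℂ) - 1‖
      ≤ KG * ((τn + ρn) + ϵ * (τf + ρf)) + ‖curlAt Ft AN z μ ν‖ + 28 * α₀ ^ 2 := by
  have hrep := norm_plaq_vary_sub_one_le_of_localisedLetters hL k hFt hFt0 hx hs hFtx hA hAP hAα hNs hNP hNexact hNorth S hTS Bn Bf z hμν hGloc
    hρn hρf hEXP hτn hτf hcritD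
  have hg := norm_plaq_sub_one_le_gaugeAct (U := U) hu z μ ν
  rw [hol_plaqWord_congr h1 h2 h3 h4] at hg
  exact hg.trans hrep

/-! ## §3 THE v2 END with the owned letters discharged -/

/-- **`hape` ⇐ THE PER-PLAQUETTE BUNDLE OF THE TORUS ROAD v2** (dimension `d + 1`, every `L, N ≥ 1`; statement in the module docstring §3).  Per plaquette the
bundle posits the chart `(A, α₀, α₁, ĝ)`, the two-region defect `(τn on Bn, τf on Bf)`, the matching gauge `u`, and the LOCALISED solver letter at the plaquette
with constants `(K_G, ϵ)`; EXP is F48b's global density `ρ(α₀,α₁)` (entered in both regions), the normal part is F251 §2's (skew, exact, north, GLOBAL (R7♭) curl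
bound).  Proof: §2 at every plaquette gives the affine improvement `r ↦ c₀ + θr`, then F243's affine iteration. [cite: Balaban1985Variational, Prop. 8 p.304] -/
theorem hape_of_torusRoadLocalised [Nonempty n] {L N : ℕ} [NeZero N] (hL : 1 ≤ L) {ε δ δ₁ β c₀ θ : ℝ}
    (hc₀ : 0 ≤ c₀) (hθ0 : 0 ≤ θ) (hθ1 : θ < 1) (hcδ : c₀ + θ * δ ≤ δ) (hδ₁ : c₀ / (1 - θ) < δ₁)
    (hloc : ∀ D : Site (d + 1) → Fin (d + 1) → (Matrix n n ℂ)ˣ, IsUnitaryCfg D → IsPeriodicCfg D (N : ℤ) → SmallField D (4 * (Real.exp β - 1)) →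
      ∀ (k : ℕ), ∀ U ∈ admissible (sfClass (d + 1) L N ε) L (k + 1) D,
      (∀ φ : Site (d + 1) → Fin (d + 1) → Matrix n n ℂ, IsSkewDir φ → IsPeriodicDir φ ((N * L ^ (k + 1) : ℕ) : ℤ) → TangentIter L k U φ →
        dAction U φ (perWin (d + 1) (N * L ^ (k + 1))) = 0) →
      ∀ r : ℝ, 0 ≤ r → r ≤ δ → SmallField U (r / ((L : ℝ) ^ (k + 1)) ^ 2) →
      ∀ (z : Site (d + 1)) (μ ν : Fin (d + 1)), μ ≠ ν →
        ∃ (A : Site (d + 1) → Fin (d + 1) → Matrix n n ℂ) (α₀ α₁ τn τf g : ℝ) (u : Site (d + 1) → (Matrix n n ℂ)ˣ)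
          (Bn Bf : Finset (Site (d + 1))) (ϵ KG : ℝ),
          -- the chart, cut off ((N1) + cutoff): skew, periodic, sup `α₀`, lattice gradient `α₁`, coarse curl `ĝ` of its linearised top average
          (IsSkewDir A ∧ IsPeriodicDir A ((N * L ^ (k + 1) : ℕ) : ℤ) ∧ 0 ≤ α₀ ∧ 0 ≤ α₁ ∧ (∀ y κ, ‖A y κ‖ ≤ α₀) ∧
            (∀ (y : Site (d + 1)) (κ τ' : Fin (d + 1)), ‖A (y + e τ') κ - A y κ‖ ≤ α₁) ∧
            (∀ (y : Site (d + 1)) (μ' ν' : Fin (d + 1)),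
              ‖curlAt (flat (d := d + 1) (n := n)) (dirIter L (k + 1) (flat (d := d + 1) (n := n)) A) y μ' ν'‖ ≤ g)) ∧
          -- the two-region criticality defect of `e^{A}` on skew periodic flat tangents ((N2): near = paired Euler–Lagrange term, far = shell commutators)
          (0 ≤ τn ∧ 0 ≤ τf ∧ ∀ Y : Site (d + 1) → Fin (d + 1) → Matrix n n ℂ, IsSkewDir Y → IsPeriodicDir Y ((N * L ^ (k + 1) : ℕ) : ℤ) →
            dirIter L (k + 1) (flat (d := d + 1) (n := n)) Y = 0 →
            |dAction (vary (flat (d := d + 1) (n := n)) A 1) Y (perWin (d + 1) (N * L ^ (k + 1)))| ≤ τn * dirL1 Y Bn + τf * dirL1 Y Bf) ∧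
          -- the gauge matching `U` to `e^{A}` on the four bonds of the plaquette
          (IsUnitarySite u ∧ gaugeAct u U z μ = vary (flat (d := d + 1) (n := n)) A 1 z μ ∧
            gaugeAct u U (z + e μ) ν = vary (flat (d := d + 1) (n := n)) A 1 (z + e μ) ν ∧
            gaugeAct u U (z + e ν) μ = vary (flat (d := d + 1) (n := n)) A 1 (z + e ν) μ ∧
            gaugeAct u U z ν = vary (flat (d := d + 1) (n := n)) A 1 z ν) ∧
          -- the LOCALISED slice solver letter at the plaquette (G♭-loc TYPE; `periodBox ⊆ Bn ∪ Bf` is the supplier's business)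
          (0 ≤ ϵ ∧ (periodBox (d := d + 1) (N * L ^ (k + 1)) : Finset (Site (d + 1))) ⊆ Bn ∪ Bf ∧
            ∀ X : Site (d + 1) → Fin (d + 1) → Matrix n n ℂ, IsSkewDir X → IsPeriodicDir X ((N * L ^ (k + 1) : ℕ) : ℤ) →
            dirIter L (k + 1) (flat (d := d + 1) (n := n)) X = 0 → ∀ a b : ℝ, 0 ≤ a → 0 ≤ b →
            (∀ Y : Site (d + 1) → Fin (d + 1) → Matrix n n ℂ, IsSkewDir Y → IsPeriodicDir Y ((N * L ^ (k + 1) : ℕ) : ℤ) →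
              dirIter L (k + 1) (flat (d := d + 1) (n := n)) Y = 0 →
              |hess (flat (d := d + 1) (n := n)) X Y (perWin (d + 1) (N * L ^ (k + 1)))| ≤ a * dirL1 Y Bn + b * dirL1 Y Bf) →
            ‖curlAt (flat (d := d + 1) (n := n)) X z μ ν‖ ≤ KG * (a + ϵ * b)) ∧
          -- the numeric line (EXP's global `ρ(α₀,α₁)` in both regions, (R7♭)'s `card n·(C_H∕M)·(ĝ∕M)`)
          KG * ((τn + ((Fintype.card (T4AveragingDeficitWall.Plane (d + 1)) : ℝ)
              * (2 * (8 * α₀ * (2 * α₁ + 28 * α₀ ^ 2) + 6 * (Real.exp α₀ - 1) * (2 * α₁ + 24 * (Real.exp α₀ - 1) * α₀)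
                  + (2 * α₁ + 24 * (Real.exp α₀ - 1) * α₀) * (2 * α₁ + 28 * α₀ ^ 2) + 960 * (Real.exp α₀ - 1) * α₀ ^ 2)
                + 64 * α₀ * α₁)))
              + ϵ * (τf + ((Fintype.card (T4AveragingDeficitWall.Plane (d + 1)) : ℝ)
              * (2 * (8 * α₀ * (2 * α₁ + 28 * α₀ ^ 2) + 6 * (Real.exp α₀ - 1) * (2 * α₁ + 24 * (Real.exp α₀ - 1) * α₀)
                  + (2 * α₁ + 24 * (Real.exp α₀ - 1) * α₀) * (2 * α₁ + 28 * α₀ ^ 2) + 960 * (Real.exp α₀ - 1) * α₀ ^ 2)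
                + 64 * α₀ * α₁))))
            + Fintype.card n * ((2 * (CdecD d * (((d : ℝ) + 1) * (2 * ((d : ℝ) + 1))
              * ((2 + 32 / (kappa163 (d + 1) / (d + 1)) ^ 2) * latticeConst (d + 1) (kappa163 (d + 1) / (d + 1) / 2)))))
              / ((L ^ (k + 1) : ℕ) : ℝ) * (g / ((L ^ (k + 1) : ℕ) : ℝ)))
            + 28 * α₀ ^ 2 ≤ (c₀ + θ * r) / ((L : ℝ) ^ (k + 1)) ^ 2) :
    ∀ D : Site (d + 1) → Fin (d + 1) → (Matrix n n ℂ)ˣ, IsUnitaryCfg D → IsPeriodicCfg D (N : ℤ) → SmallField D (4 * (Real.exp β - 1)) →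
      ∀ (k : ℕ), ∀ U ∈ admissible (sfClass (d + 1) L N ε) L (k + 1) D, SmallField U (δ / ((L : ℝ) ^ (k + 1)) ^ 2) →
      (∀ φ : Site (d + 1) → Fin (d + 1) → Matrix n n ℂ, IsSkewDir φ → IsPeriodicDir φ ((N * L ^ (k + 1) : ℕ) : ℤ) → TangentIter L k U φ →
        dAction U φ (perWin (d + 1) (N * L ^ (k + 1))) = 0) → SmallField U (δ₁ / ((L : ℝ) ^ (k + 1)) ^ 2) := by
  classical
  intro D hDu hDP hDs k U hU hUδ hcrit
  have hLpos : (0 : ℝ) < L := by exact_mod_cast (by omega : 0 < L)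
  have hS : 0 < ((L : ℝ) ^ (k + 1)) ^ 2 := by positivity
  haveI : NeZero (L ^ (k + 1)) := ⟨pow_ne_zero _ (by omega)⟩
  have hmc : N * L ^ (k + 1) = L ^ (k + 1) * N := Nat.mul_comm _ _
  have hP1 : 1 ≤ N * L ^ (k + 1) := Nat.one_le_iff_ne_zero.mpr (Nat.mul_ne_zero (NeZero.ne N) (pow_ne_zero _ (by omega)))
  have hflatU : IsUnitaryCfg (flat (d := d + 1) (n := n)) := (flat_mem_classes (d := d + 1) (n := n) le_rfl).1
  have hflat0 : SmallField (flat (d := d + 1) (n := n)) 0 := (flat_mem_classes (d := d + 1) (n := n) le_rfl).2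
  -- the affine improvement at this configuration, plaquette by plaquette
  have himp : ∀ r : ℝ, 0 ≤ r → r ≤ δ → SmallField U (r / ((L : ℝ) ^ (k + 1)) ^ 2) →
      SmallField U ((c₀ + θ * r) / ((L : ℝ) ^ (k + 1)) ^ 2) := by
    intro r hr0 hrδ hUr z μ ν hμν
    obtain ⟨A, α₀, α₁, τn, τf, g, u, Bn, Bf, ϵ, KG, ⟨hA, hAP, hα₀, hα₁, hAα, hA1, hg⟩, ⟨hτn, hτf, hcritD⟩, ⟨hu, h1, h2, h3, h4⟩,
      ⟨-, hcover, hGloc⟩, hnum⟩ := hloc D hDu hDP hDs k U hU hcrit r hr0 hrδ hUr z μ ν hμν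
    -- EXP's global density `ρ(α₀, α₁)` (F48b), abbreviated
    set ρx : ℝ := ((Fintype.card (T4AveragingDeficitWall.Plane (d + 1)) : ℝ)
        * (2 * (8 * α₀ * (2 * α₁ + 28 * α₀ ^ 2) + 6 * (Real.exp α₀ - 1) * (2 * α₁ + 24 * (Real.exp α₀ - 1) * α₀)
            + (2 * α₁ + 24 * (Real.exp α₀ - 1) * α₀) * (2 * α₁ + 28 * α₀ ^ 2) + 960 * (Real.exp α₀ - 1) * α₀ ^ 2)
          + 64 * α₀ * α₁)) with hρx
    have hδe : 0 ≤ Real.exp α₀ - 1 := by linarith [Real.add_one_le_exp α₀]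
    have hρ0 : 0 ≤ ρx := by rw [hρx]; positivity
    -- the owned normal part (F251 §2), period spelled `N·L^{k+1}`
    have hAP' : IsPeriodicDir A ((L ^ (k + 1) * N : ℕ) : ℤ) := by rw [← hmc]; exact hAP
    obtain ⟨AN, hNs, hNP, hNexact, hNorth, hNcurl⟩ := exists_flat_normalPart (n := n) hL k N hA hAP' hg
    have hNP' : IsPeriodicDir AN ((N * L ^ (k + 1) : ℕ) : ℤ) := by rw [hmc]; exact hNP
    have hNorth' : ∀ Y : Site (d + 1) → Fin (d + 1) → Matrix n n ℂ, IsSkewDir Y → IsPeriodicDir Y ((N * L ^ (k + 1) : ℕ) : ℤ) →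
        dirIter L (k + 1) (flat (d := d + 1) (n := n)) Y = 0 →
        hess (flat (d := d + 1) (n := n)) AN Y (perWin (d + 1) (N * L ^ (k + 1))) = 0 := by
      intro Y hY hYP hYT
      rw [hmc] at hYP ⊢
      exact hNorth Y hY hYP hYT
    -- EXP (F48b) entered in both regions through `periodBox ⊆ Bn ∪ Bf`
    have hEXP2 : ∀ Y : Site (d + 1) → Fin (d + 1) → Matrix n n ℂ, IsSkewDir Y → IsPeriodicDir Y ((N * L ^ (k + 1) : ℕ) : ℤ) →
        |dAction (vary (flat (d := d + 1) (n := n)) A 1) Y (perWin (d + 1) (N * L ^ (k + 1)))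
            - hess (flat (d := d + 1) (n := n)) A Y (perWin (d + 1) (N * L ^ (k + 1)))| ≤ ρx * dirL1 Y Bn + ρx * dirL1 Y Bf := by
      intro Y hY hYP
      have h := abs_dAction_vary_sub_hess_flat_le hP1 hA hAP hα₀ hα₁ hAα hA1 hY hYP
      rw [← hρx] at h
      have hcov := dirL1_le_add_of_subset_union Y hcover
      have hmul : ρx * dirL1 Y (periodBox (d := d + 1) (N * L ^ (k + 1))) ≤ ρx * (dirL1 Y Bn + dirL1 Y Bf) :=
        mul_le_mul_of_nonneg_left hcov hρ0
      linarith
    -- §2 at this plaquette, `S := univ`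
    have hplaq := norm_plaq_sub_one_le_of_localisedLetters_gauge (d := d + 1) (n := n) hL k hflatU hflat0 le_rfl (levelSmall_zero L k) hflat0
      hA hAP hAα hNs hNP' hNexact hNorth' Set.univ (Set.mem_univ _) Bn Bf z hμν
      (fun X _ hXs hXP hXT a b ha hb hsrc => hGloc X hXs hXP hXT a b ha hb hsrc) hρ0 hρ0 hEXP2 hτn hτf hcritD hu h1 h2 h3 h4
    have hc := hNcurl z μ ν
    exact hplaq.trans (by linarith)
  exact smallField_floor_of_affineImprovement hS hc₀ hθ0 hθ1 hcδ hδ₁ himp hUδ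

end

end Summit.QuantumFields.BalabanUV.T4Continuum.NE7ApeFlatSkeletonLocalised
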